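import Literature.AlgebraicGeometry.Motives.UniversalHypersurfaceFamily
import Literature.AlgebraicGeometry.HodgeTheory.SpreadingOutQbarFamilyProofs
import HarnessLib

/-!
# The universal hypersurface and the universal family of smooth hypersurfaces are quasi-projective

Family `hodge`, layer `Literature/AlgebraicGeometry/Motives`. THEOREMS ONLY (no definition, no named
fact; D-0026 net debt `0`). For a field `k` and `n d : ℕ`, with `R = k[a_m | |m| = d]` the coordinate
ring of the affine space `S^d = Spec R` of forms of degree `d` on `ℙⁿ⁺¹` and `𝒴 = V₊(F) ⊆ ℙⁿ⁺¹_R` the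
universal hypersurface (`Motives/UniversalHypersurfaceFamily`):

* `IsQuasiProjectiveOver.of_isOpenImmersion` — an open subscheme (open `k`-immersion) of a
  quasi-projective `k`-scheme is quasi-projective (Hartshorne II §4, p. 103: composition of the open
  immersion with the open immersion into a projective scheme);
* `isQuasiProjectiveOver_specCoeff` — `S^d = Spec R` is quasi-projective over `k` (affine of finite
  type; the tree's `SpreadingOutQbar.isQuasiProjectiveOver_specOver`);
* `isQuasiProjectiveOver_base` — the base `U ⊆ S^d` of the universal family of SMOOTH hypersurfaces
  (the open set of nonsingular forms, Voisin II §6.2.1 "the Zariski open set `B ⊂ H⁰(X, 𝒪_X(Y))`") is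
  quasi-projective over `k`;
* `isQuasiProjectiveOver_totalSpaceOver` — **the universal hypersurface `𝒴 ⊆ ℙⁿ⁺¹ × S^d` is
  quasi-projective over `k`**: `𝒴 ↪ ℙⁿ⁺¹_R` is a closed immersion over the affine `k`-scheme of finite
  type `Spec R`, so the tree's `SpreadingOutQbar.isQuasiProjectiveOver_of_proj_over_specOver`
  (`ℙᴺ_R ≅ ℙᴺ_k ×_k Spec R ↪ ℙᴺ_k ×_k S̄`, Segre) applies (Hartshorne II §4 p. 103 and Ex. 4.9);
* `isQuasiProjectiveOver_total` — **the total space `𝒴_U` of the universal family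
  `family k n d : 𝒴_U → U` of smooth hypersurfaces of degree `d` in `ℙⁿ⁺¹` is quasi-projective over
  `k`** (it is the open subscheme of `𝒴` over `U`).

In print (Voisin II §6.2.1, p. 162): the universal smooth hypersurface `𝒴_B ⊂ B × X` over the Zariski
open set `B` of smooth members of `|𝒪_X(d)|`, `X = ℙⁿ⁺¹`; quasi-projectivity of a locally closed
subscheme of `ℙᴺ × 𝔸ᴹ ⊆ ℙᴺ × ℙᴹ ↪ ℙ^{NM+N+M}` is Hartshorne II §4 (definition p. 103) with Ex. 4.9
(Segre). The `M`-supported sibling `isQuasiProjectiveOver_totalM` (file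
`Motives/MonomialSupportedFamilyQuasiProjective`, via the incidence variety `W_M`) covers the families
`familyM`; this file covers the full family `family k n d` itself, by the direct route.

Consumers: every use of the tree's global-invariant-cycle / Hodge-locus / Hodge-generic monodromy
theorems (`deligne_globalInvariantCycles`, `cmsp_nonHodgeGenericPoints_countable_algebraic_cover`,
`deligne_finiteIndex_monodromy_le_mumfordTateGroup_of_isQuasiProjectiveOver`) on the universal family
`family ℂ n d` needs `IsQuasiProjectiveOver` of its base and (for the last) of its total space.

## References

* [VoisinHodgeII2003] C. Voisin, Hodge Theory and Complex Algebraic Geometry II, CUP 2003, §6.2.1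
  (p. 162).
* [Hartshorne1977] R. Hartshorne, Algebraic Geometry, GTM 52, II §4 (quasi-projective morphisms,
  p. 103), II Ex. 4.9 (Segre embedding).
-/

noncomputable section

open CategoryTheory AlgebraicGeometry

universe u

namespace Literature.AlgebraicGeometry.HodgeTheory.IsQuasiProjectiveOver

/-- **An open subscheme of a quasi-projective `k`-scheme is quasi-projective**: compose the open
`k`-immersion `i : X ⟶ Y` with an open immersion `Y ⟶ P` into a projective `k`-scheme.
[cite: Hartshorne1977, II §4 Definition (quasi-projective morphism), p. 103] -/
theorem of_isOpenImmersion {k : Type u} [Field k] {X Y : Motives.SchemeOver k} (i : X ⟶ Y)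
    [IsOpenImmersion i.left] (hY : IsQuasiProjectiveOver Y) : IsQuasiProjectiveOver X := by
  obtain ⟨P, j, hP, hj⟩ := hY
  haveI := hj
  refine ⟨P, i ≫ j, hP, ?_⟩
  rw [Over.comp_left]
  infer_instance

end Literature.AlgebraicGeometry.HodgeTheory.IsQuasiProjectiveOver

namespace Literature.AlgebraicGeometry.Motives.UniversalHypersurface

open HodgeTheory (IsQuasiProjectiveOver)

variable (k : Type u) [Field k] (n d : ℕ)

/-- **The affine space of forms `S^d = Spec k[a_m | |m| = d]` is quasi-projective over `k`** (an affine
`k`-scheme of finite type; `specOver k (CoeffRing k n d)` has structure morphism `specCoeffToSpec`).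
[cite: Hartshorne1977, II §4 Definition (quasi-projective morphism), p. 103] -/
theorem isQuasiProjectiveOver_specCoeff :
    IsQuasiProjectiveOver (specOver k (CoeffRing k n d)) :=
  HodgeTheory.SpreadingOutQbar.isQuasiProjectiveOver_specOver (k := k) (CoeffRing k n d)

/-- The open immersion `U ↪ S^d` of the base of the universal family into the affine space of forms, as
a morphism of `k`-schemes. [cite: VoisinHodgeII2003, §6.2.1] -/
def baseToSpecCoeff : base k n d ⟶ specOver k (CoeffRing k n d) :=
  Over.homMk (baseOpens k n d).ι rfl

/-- The underlying morphism of `baseToSpecCoeff` is the inclusion `U.ι` (`rfl`).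
[cite: VoisinHodgeII2003, §6.2.1] -/
theorem baseToSpecCoeff_left : (baseToSpecCoeff k n d).left = (baseOpens k n d).ι := rfl

/-- `U ↪ S^d` is an open immersion. [cite: VoisinHodgeII2003, §6.2.1] -/
theorem isOpenImmersion_baseToSpecCoeff_left : IsOpenImmersion (baseToSpecCoeff k n d).left :=
  inferInstanceAs (IsOpenImmersion (baseOpens k n d).ι)

/-- **The base `U ⊆ S^d` of the universal family of smooth hypersurfaces of degree `d` in `ℙⁿ⁺¹_k`
(the Zariski open set of nonsingular forms) is quasi-projective over `k`**: open in the affine space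
`S^d`. [cite: VoisinHodgeII2003, §6.2.1] [cite: Hartshorne1977, II §4 (p. 103)] -/
theorem isQuasiProjectiveOver_base : IsQuasiProjectiveOver (base k n d) :=
  haveI := isOpenImmersion_baseToSpecCoeff_left k n d
  IsQuasiProjectiveOver.of_isOpenImmersion (baseToSpecCoeff k n d)
    (isQuasiProjectiveOver_specCoeff k n d)

/-- The universal hypersurface `𝒴 = V₊(F) ⊆ ℙⁿ⁺¹_R` over the WHOLE affine space of forms, as a
`k`-scheme (structure morphism `𝒴 → S^d → Spec k`). [cite: VoisinHodgeII2003, §6.2.1] -/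
def totalSpaceOver : SchemeOver k :=
  Over.mk (totalToSpec k n d ≫ (specOver k (CoeffRing k n d)).hom)

/-- The structure morphism of `totalSpaceOver`: `𝒴 → S^d → Spec k` (`rfl`). [cite: VoisinHodgeII2003, §6.2.1] -/
theorem totalSpaceOver_hom :
    (totalSpaceOver k n d).hom = totalToSpec k n d ≫ (specOver k (CoeffRing k n d)).hom := rfl

/-- **The universal hypersurface `𝒴 ⊆ ℙⁿ⁺¹ × S^d` is quasi-projective over `k`**: `𝒴 ↪ ℙⁿ⁺¹_R` is a
closed immersion compatible with the proper projection `𝒴 → Spec R`, `R = k[a_m]` of finite type over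
`k`, so `SpreadingOutQbar.isQuasiProjectiveOver_of_proj_over_specOver` applies
(`ℙⁿ⁺¹_R ≅ ℙⁿ⁺¹_k ×_k Spec R ↪ ℙⁿ⁺¹_k ×_k S̄`, `S̄` a projective closure of `Spec R`, Segre).
[cite: Hartshorne1977, II §4 (p. 103) and Ex. 4.9] [cite: VoisinHodgeII2003, §6.2.1] -/
theorem isQuasiProjectiveOver_totalSpaceOver : IsQuasiProjectiveOver (totalSpaceOver k n d) :=
  HodgeTheory.SpreadingOutQbar.isQuasiProjectiveOver_of_proj_over_specOver (k := k)
    (CoeffRing k n d) (N := n + 1) (totalToSpec k n d) (totalι k n d) rfl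

/-- The open immersion `𝒴_U ↪ 𝒴` of the total space of the universal family of SMOOTH hypersurfaces
into the universal hypersurface, as a morphism of `k`-schemes (`(ψ⁻¹ U).ι`, `ψ : 𝒴 → S^d`).
[cite: VoisinHodgeII2003, §6.2.1] -/
def totalToTotalSpaceOver : total k n d ⟶ totalSpaceOver k n d :=
  Over.homMk ((totalToSpec k n d) ⁻¹ᵁ (baseOpens k n d)).ι (by
    change ((totalToSpec k n d) ⁻¹ᵁ (baseOpens k n d)).ι ≫ totalToSpec k n d ≫
        (specOver k (CoeffRing k n d)).hom =
      familyHom k n d ≫ (baseOpens k n d).ι ≫ specCoeffToSpec k n d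
    rw [← Category.assoc, ← morphismRestrict_ι, Category.assoc]
    rfl)

/-- The underlying morphism of `totalToTotalSpaceOver` is `(ψ⁻¹ U).ι` (`rfl`). [cite: VoisinHodgeII2003, §6.2.1] -/
theorem totalToTotalSpaceOver_left :
    (totalToTotalSpaceOver k n d).left = ((totalToSpec k n d) ⁻¹ᵁ (baseOpens k n d)).ι := rfl

/-- `𝒴_U ↪ 𝒴` is an open immersion. [cite: VoisinHodgeII2003, §6.2.1] -/
theorem isOpenImmersion_totalToTotalSpaceOver_left :
    IsOpenImmersion (totalToTotalSpaceOver k n d).left :=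
  inferInstanceAs (IsOpenImmersion ((totalToSpec k n d) ⁻¹ᵁ (baseOpens k n d)).ι)

/-- `𝒴_U ↪ 𝒴` followed by `ψ : 𝒴 → S^d` is `π : 𝒴_U → U` followed by `U ↪ S^d`: the restriction
square of the universal hypersurface over the open set of smooth members. [cite: VoisinHodgeII2003, §6.2.1] -/
theorem totalToTotalSpaceOver_left_comp_totalToSpec :
    (totalToTotalSpaceOver k n d).left ≫ totalToSpec k n d = familyHom k n d ≫ (baseOpens k n d).ι :=
  (morphismRestrict_ι (totalToSpec k n d) (baseOpens k n d)).symm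

/-- **The total space `𝒴_U` of the universal family `family k n d : 𝒴_U → U` of smooth hypersurfaces of
degree `d` in `ℙⁿ⁺¹_k` is quasi-projective over `k`** (open in the quasi-projective `𝒴`; Voisin II
§6.2.1, the universal smooth hypersurface over the open set `B` of smooth members).
[cite: VoisinHodgeII2003, §6.2.1] [cite: Hartshorne1977, II §4 (p. 103) and Ex. 4.9] -/
theorem isQuasiProjectiveOver_total : IsQuasiProjectiveOver (total k n d) :=
  haveI := isOpenImmersion_totalToTotalSpaceOver_left k n d
  IsQuasiProjectiveOver.of_isOpenImmersion (totalToTotalSpaceOver k n d)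
    (isQuasiProjectiveOver_totalSpaceOver k n d)

end Literature.AlgebraicGeometry.Motives.UniversalHypersurface

end
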